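import Summits.QuantumFields.YangMills.Theses.FradkinShenkerFlow
import Summits.QuantumFields.YangMills.Theorems.HypercubicLimit.Negative.AllTimesGapFalse
import Summits.QuantumFields.YangMills.Theorems.CurvatureBoostCovariance.Negative.BetaZeroTie
import Summits.QuantumFields.YangMills.Theorems.LatticeGapOnTrajectory.Negative.ZeroCouplingGap
import Summits.QuantumFields.YangMills.Theorems.OSLegsFromFemtoAndGap.Negative.UnitsAndGapFree

/-!
# `ClusteringToYangMills` — negative-side support: disproof burden and tightness of the clustering hypothesis

Support file for crux `stmt-QuantumFields-9443`
(`Summit.QuantumFields.YangMills.Theses.FradkinShenkerFlow.ClusteringToYangMills`, the imported complement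
"volume-uniform exponential clustering on tori at all `β ≥ β₀(G, r)`, every compact simple `G`, every faithful
`r` ⟹ `YangMills`"), extracted from the standing disprover's work file
`Cruxes/ClusteringToYangMills/Disproof.lean` (cycle 1).  Tree objects only, nothing posited.

* `su2_clustering_of_not_clusteringToYangMills`: a refutation of the crux (which trivially also refutes the typed
  Clay statement, `¬(H → YM) ⊢ ¬YM`) proves the weak-coupling lattice mass gap of `SU(2)` (Wilson's fundamental
  action) — the item is irrefutable short of both.
* `clustering_perVolume`: with the constant allowed to depend on the volume, exponential clustering in Euclidean
  time holds for EVERY `G, r, β` and every rate (a priori bound) — the order `∃ C ∀ S` is the whole content of the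
  hypothesis.
* `not_clusteringAllTimes_at`, `not_latticeClusteringAllTimes`: the hypothesis with the thermal restriction
  `n ≤ S` removed is FALSE on every torus for every non-abelian `G`, faithful `r`, `β`, rate `m > 0`
  (periodicity + positive variance of the curvature); so `n ≤ S` is what keeps the crux from being vacuous.
* `clustering_zero_coupling`: at `β = 0` the hypothesis holds for every `G, r` (independent Haar links).
* `yangMillsShape_without_nontriviality`: the conclusion with `IsNontrivial ∧ IsNonGaussian` deleted is a theorem.
* `not_isNontrivial_of_frequently_beta_zero'`, `yangMills_witness_beta_ne_zero`: every witness of `YangMills`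
  has `β_k ≠ 0` eventually (re-derivation, for the summit conclusion itself, of the HypercubicLimit disprover's
  `BetaMustLeaveZero` via `tie_beta_zero_factorises`). [folklore]
-/

noncomputable section

open scoped SchwartzMap
open Filter Topology MeasureTheory
open Literature.MathematicalPhysics.AQFT Literature.MathematicalPhysics.QuantumLattice
open Literature.MathematicalPhysics.QuantumFieldTheory
open Summit.QuantumFields.YangMills.Theses.FradkinShenkerFlow
open Summit.QuantumFields.YangMills.Theorems.HypercubicLimit.Negative
open Summit.QuantumFields.YangMills.Theorems.LatticeGapOnTrajectory.Negative
open Summit.QuantumFields.YangMills.Theorems.OSLegsFromFemtoAndGap.Negative (isCompactSimpleLieGroup_su2)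

namespace Summit.QuantumFields.YangMills.Theorems.ClusteringToYangMills.Negative

/-! ## Disproof burden -/

section Burden

/-- **Any refutation of the crux proves the weak-coupling lattice mass gap of `SU(2)`**: volume-uniform
exponential clustering in Euclidean time of Wilson's `SU(2)` theory (fundamental action) at all large `β` —
the infrared half of the Millennium problem on the lattice (Chatterjee, Problem 5.1), open since 1974.
[folklore] -/
theorem su2_clustering_of_not_clusteringToYangMills (h : ¬ ClusteringToYangMills) :
    ∃ β₀ : ℝ, ∀ β : ℝ, β₀ ≤ β → ∃ m : ℝ, 0 < m ∧
      ∀ A B : YMSpecies (Matrix.specialUnitaryGroup (Fin 2) ℂ), ∃ C : ℝ, ∀ S n : ℕ, n ≤ S →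
        |latticeConnectedCorr (fundamentalRep (Fin 2)) β (2 * S + 1) A.F B.F n| ≤ C * Real.exp (-(m * n)) := by
  by_contra hSU
  refine h fun hLC => ?_
  exact (hSU (hLC (Matrix.specialUnitaryGroup (Fin 2) ℂ) isCompactSimpleLieGroup_su2
    ⟨2, fundamentalRep (Fin 2), continuous_fundamentalRep _, fundamentalRep_injective _,
      fundamentalRep_mem_unitaryGroup⟩)).elim

end Burden

/-! ## Tightness of the clustering hypothesis -/

section Hypothesis

variable {G : Type} [Group G] [TopologicalSpace G] [IsTopologicalGroup G] [CompactSpace G]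
  [MeasurableSpace G] [BorelSpace G]

/-- **Per-volume clustering is contentless.** For every `G, r, β`, every rate `m` and every pair of local gauge
observables, on EACH torus separately there is a constant: `|corr| ≤ 2‖A‖∞‖B‖∞ e^{|m| S} e^{−m n}` for `n ≤ S`.
The order of quantifiers `∃ C ∀ S` carries the entire content of the crux's hypothesis; with `∀ S ∃ C` the item
would be literally `YangMills`. [folklore] -/
theorem clustering_perVolume (r : LatticeRep G) (β m : ℝ) (A B : YMSpecies G) (S : ℕ) :
    ∃ C : ℝ, ∀ n : ℕ, n ≤ S →
      |latticeConnectedCorr r.ρ β (2 * S + 1) A.F B.F n| ≤ C * Real.exp (-(m * n)) := by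
  obtain ⟨CA, hCA⟩ := A.bounded
  obtain ⟨CB, hCB⟩ := B.bounded
  refine ⟨2 * (CA * CB) * Real.exp (|m| * S), fun n hn => ?_⟩
  have h := abs_latticeConnectedCorr_le r β (2 * S + 1) hCA hCB n
  have hCAB : 0 ≤ 2 * (CA * CB) := le_trans (abs_nonneg _) h
  have hexp : 1 ≤ Real.exp (|m| * S) * Real.exp (-(m * n)) := by
    rw [← Real.exp_add, Real.one_le_exp_iff]
    have hnS : (n : ℝ) ≤ S := by exact_mod_cast hn
    have hn0 : (0 : ℝ) ≤ n := Nat.cast_nonneg _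
    have h1 : m * n ≤ |m| * n := mul_le_mul_of_nonneg_right (le_abs_self m) hn0
    have h2 : |m| * n ≤ |m| * S := mul_le_mul_of_nonneg_left hnS (abs_nonneg m)
    linarith
  calc |latticeConnectedCorr r.ρ β (2 * S + 1) A.F B.F n| ≤ 2 * (CA * CB) * 1 := by rw [mul_one]; exact h
    _ ≤ 2 * (CA * CB) * (Real.exp (|m| * S) * Real.exp (-(m * n))) := mul_le_mul_of_nonneg_left hexp hCAB
    _ = 2 * (CA * CB) * Real.exp (|m| * S) * Real.exp (-(m * n)) := by ring

/-- **No torus admits an all-times exponential bound for the curvature autocorrelation** (non-abelian `G`,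
faithful `r`, any `β`, any rate `m > 0`, any side `2S+1`): by periodicity `corr(k(2S+1)) = corr(0)` is the
variance of the action density, positive under the fully supported Wilson measure, while the bound tends to `0`
as `k → ∞`.  The thermal restriction `n ≤ S` in the crux's hypothesis (and in `HasLatticeMassGap`) is therefore
essential: without it the hypothesis is unsatisfiable and the crux vacuous. [folklore] -/
theorem not_clusteringAllTimes_at (hG : ∃ a b : G, a * b ≠ b * a) (r : LatticeRep G) (β : ℝ) {m : ℝ}
    (hm : 0 < m) (S : ℕ) :
    ¬ ∃ C : ℝ, ∀ n : ℕ, |latticeConnectedCorr r.ρ β (2 * S + 1) r.curvature.F r.curvature.F n| ≤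
      C * Real.exp (-(m * n)) := by
  rintro ⟨C, hC⟩
  obtain ⟨a, b, hab⟩ := hG
  have hbound : ∀ k : ℕ, |latticeConnectedCorr r.ρ β (2 * S + 1) r.curvature.F r.curvature.F 0| ≤
      C * Real.exp (-(m * ((0 + k * (2 * S + 1) : ℕ) : ℝ))) := fun k => by
    rw [← latticeConnectedCorr_add_mul_side r.ρ β (2 * S + 1) r.curvature.F r.curvature.F 0 k]
    exact hC _
  have hlim : Tendsto (fun k : ℕ => C * Real.exp (-(m * ((0 + k * (2 * S + 1) : ℕ) : ℝ)))) atTop (𝓝 0) := by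
    have h1 : Tendsto (fun k : ℕ => m * ((0 + k * (2 * S + 1) : ℕ) : ℝ)) atTop atTop := by
      have : (fun k : ℕ => m * ((0 + k * (2 * S + 1) : ℕ) : ℝ)) =
          fun k : ℕ => (m * ((2 * S + 1 : ℕ) : ℝ)) * (k : ℝ) := by
        funext k; push_cast; ring
      rw [this]
      exact Tendsto.const_mul_atTop (mul_pos hm (by positivity)) tendsto_natCast_atTop_atTop
    have h2 := Real.tendsto_exp_atBot.comp (tendsto_neg_atTop_atBot.comp h1)
    simpa using h2.const_mul C
  have h0 : |latticeConnectedCorr r.ρ β (2 * S + 1) r.curvature.F r.curvature.F 0| ≤ 0 :=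
    ge_of_tendsto' hlim hbound
  have hz : latticeConnectedCorr r.ρ β (2 * S + 1) r.curvature.F r.curvature.F 0 = 0 :=
    abs_eq_zero.1 (le_antisymm h0 (abs_nonneg _))
  rw [latticeConnectedCorr_zero_time] at hz
  have hP : Continuous fun W : GaugeConfig 4 (2 * S + 1) G => r.curvature.F (torusLift (2 * S + 1) W) :=
    (continuous_actionDensity r.continuous).comp (continuous_pi fun _ => continuous_apply _)
  have hne : r.curvature.F (torusLift (2 * S + 1)
      (fun e : Edge 4 (2 * S + 1) => if e.2 = 0 then a else if e.2 = 1 then b else (1 : G))) ≠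
      r.curvature.F (torusLift (2 * S + 1) (fun _ => 1)) := by
    rw [torusLift_dirConfigT, torusLift_one]
    exact actionDensity_ne r hab
  have hvar := variance_pos r β (2 * S + 1) hP hne
  linarith

omit [Group G] [TopologicalSpace G] [IsTopologicalGroup G] [CompactSpace G] [MeasurableSpace G]
  [BorelSpace G] in
/-- **The all-times strengthening of the crux's hypothesis is FALSE** (instantiate at `SU(2)`, fundamental
`r`, `β = β₀`, `A = B =` curvature, side-1 torus); hence the crux with that hypothesis would be vacuously true.
[folklore] -/
theorem not_latticeClusteringAllTimes :
    ¬ (∀ (G : Type) [Group G] [TopologicalSpace G] [IsTopologicalGroup G] [CompactSpace G]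
        [MeasurableSpace G] [BorelSpace G], IsCompactSimpleLieGroup G →
        ∀ r : LatticeRep G, ∃ β₀ : ℝ, ∀ β : ℝ, β₀ ≤ β → ∃ m : ℝ, 0 < m ∧
          ∀ A B : YMSpecies G, ∃ C : ℝ, ∀ S n : ℕ,
            |latticeConnectedCorr r.ρ β (2 * S + 1) A.F B.F n| ≤ C * Real.exp (-(m * n))) := by
  intro h
  set r : LatticeRep (Matrix.specialUnitaryGroup (Fin 2) ℂ) :=
    ⟨2, fundamentalRep (Fin 2), continuous_fundamentalRep _, fundamentalRep_injective _,
      fundamentalRep_mem_unitaryGroup⟩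
  obtain ⟨β₀, hβ₀⟩ := h (Matrix.specialUnitaryGroup (Fin 2) ℂ) isCompactSimpleLieGroup_su2 r
  obtain ⟨m, hm, hAB⟩ := hβ₀ β₀ le_rfl
  obtain ⟨C, hC⟩ := hAB r.curvature r.curvature
  exact not_clusteringAllTimes_at isCompactSimpleLieGroup_su2.1.2.1 r β₀ hm 0 ⟨C, fun n => hC 0 n⟩

/-- **Zero coupling satisfies the crux's hypothesis** (infinite gap), for every `G` and `r`: at `β = 0` the
connected correlation of `A` and `τ_n B` vanishes exactly once the torus projections of the supports are
disjoint (`2R < n`, `n + 2R < 2S+1`, `R` the time extent of the supports; independent Haar links) and is a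
priori bounded in the near regime `n ≤ 4R` forced otherwise by `n ≤ S`. [folklore] -/
theorem clustering_zero_coupling (r : LatticeRep G) :
    ∃ m : ℝ, 0 < m ∧ ∀ A B : YMSpecies G, ∃ C : ℝ, ∀ S n : ℕ, n ≤ S →
      |latticeConnectedCorr r.ρ 0 (2 * S + 1) A.F B.F n| ≤ C * Real.exp (-(m * n)) := by
  refine ⟨1, one_pos, fun A B => ?_⟩
  obtain ⟨CA, hCA⟩ := A.bounded
  obtain ⟨CB, hCB⟩ := B.bounded
  set R : ℕ := (A.supp ∪ B.supp).sup fun e => (e.1 0).natAbs with hR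
  have hRA : ∀ e ∈ A.supp, |e.1 0| ≤ R := fun e he => by
    have : (e.1 0).natAbs ≤ R := Finset.le_sup (f := fun e => (e.1 0).natAbs) (Finset.mem_union_left _ he)
    rw [Int.abs_eq_natAbs]; exact_mod_cast this
  have hRB : ∀ e ∈ B.supp, |e.1 0| ≤ R := fun e he => by
    have : (e.1 0).natAbs ≤ R := Finset.le_sup (f := fun e => (e.1 0).natAbs) (Finset.mem_union_right _ he)
    rw [Int.abs_eq_natAbs]; exact_mod_cast this
  have hCAB : 0 ≤ 2 * (CA * CB) :=
    le_trans (abs_nonneg _) (abs_latticeConnectedCorr_le r 0 (2 * 0 + 1) hCA hCB 0)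
  refine ⟨2 * (CA * CB) * Real.exp (1 * (4 * R + 1)), fun S n hn => ?_⟩
  by_cases hfar : 2 * R < n ∧ n + 2 * R < 2 * S + 1
  · have hdisj := disjoint_torusSupports_of_time_bound A.supp B.supp R hRA hRB hfar.1 hfar.2
    rw [latticeConnectedCorr_zero_coupling r.ρ (2 * S + 1) A B n hdisj, abs_zero]
    positivity
  · have hn4 : (n : ℝ) ≤ 4 * R + 1 := by
      have : n ≤ 4 * R + 1 := by omega
      exact_mod_cast this
    have h := abs_latticeConnectedCorr_le r 0 (2 * S + 1) hCA hCB n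
    have hexp : 1 ≤ Real.exp (1 * (4 * R + 1)) * Real.exp (-(1 * n)) := by
      rw [← Real.exp_add, Real.one_le_exp_iff]; linarith
    calc |latticeConnectedCorr r.ρ 0 (2 * S + 1) A.F B.F n| ≤ 2 * (CA * CB) * 1 := by rw [mul_one]; exact h
      _ ≤ 2 * (CA * CB) * (Real.exp (1 * (4 * R + 1)) * Real.exp (-(1 * n))) :=
          mul_le_mul_of_nonneg_left hexp hCAB
      _ = 2 * (CA * CB) * Real.exp (1 * (4 * R + 1)) * Real.exp (-(1 * n)) := by ring

end Hypothesis

/-! ## The conclusion modulo junk -/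

section Conclusion

variable {G : Type} [Group G] [TopologicalSpace G] [IsTopologicalGroup G] [CompactSpace G]

omit [IsTopologicalGroup G] in
/-- **`YangMills` minus non-triviality is a theorem**: for every compact simple `G` the zero scheme (`β ≡ 0`,
`c = m = 0`) and the vacuum OS datum satisfy `IsYangMillsFor` with every mass gap, continuum and lattice.  So a
proof of the crux can use its hypothesis for nothing but the INTERACTING continuum limit. [folklore] -/
theorem yangMillsShape_without_nontriviality [IsTopologicalGroup G] (hG : IsCompactSimpleLieGroup G) :
    letI : MeasurableSpace G := borel G
    haveI : BorelSpace G := ⟨rfl⟩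
    ∃ (r : LatticeRep G) (sch : SpeciesScheme (YMSpecies G)) (T : OSData (YMSpecies G) 4),
      IsYangMillsFor r sch T ∧ ∃ Δ > 0, T.HasMassGap Δ ∧ HasLatticeMassGap r sch Δ := by
  letI : MeasurableSpace G := borel G
  haveI : BorelSpace G := ⟨rfl⟩
  obtain ⟨r⟩ := hG.2
  obtain ⟨sch, T, hYM, hgap⟩ := gap_clauses_junk_reachable r
  exact ⟨r, sch, T, hYM, 1, one_pos, hgap 1⟩

/-- **`β_k = 0` frequently ⇒ no witness**: if a scheme returns to zero coupling infinitely often, every OS datum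
tied to it by `IsYangMillsFor` is trivial in `tr F²` (the curvature two-point function factorises on real
off-diagonal tensors by `tie_beta_zero_factorises`; real→complex bridge `not_twoPointNontrivial_of_factorizes`).
[folklore] -/
theorem not_isNontrivial_of_frequently_beta_zero' [MeasurableSpace G] [BorelSpace G]
    (r : LatticeRep G) (sch : SpeciesScheme (YMSpecies G)) (T : OSData (YMSpecies G) 4)
    (hβ : ∃ᶠ k in atTop, sch.β k = 0) (hT : IsYangMillsFor r sch T) : ¬ T.IsNontrivial r.curvature := by
  have hconv : ∀ (n : ℕ), n ≠ 0 → ∀ (f : Fin n → 𝓢(EuclideanSpace ℝ (Fin 4), ℝ))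
      (F : 𝓢((Fin n → EuclideanSpace ℝ (Fin 4)), ℂ)), IsTensorOf F (fun i => ofRealTest (f i)) →
      IsOffDiagonal F → Tendsto (fun k : ℕ => ((latticeSchwinger r.ρ sch (fun s => s.F) k n
        (fun _ => r.curvature) f : ℝ) : ℂ)) atTop (𝓝 (T.schwinger n (fun _ => r.curvature) F)) :=
    fun n hn f F hF hF' => hT n hn (fun _ => r.curvature) f F hF hF'
  refine not_twoPointNontrivial_of_factorizes T.schwinger r.curvature fun u v hu hv => ?_
  have hod : IsOffDiagonal (tensor₂ u v) := isOffDiagonal_of_halfSpaces hu hv (isTensorOf_tensor₂ u v)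
  have h := Summit.QuantumFields.YangMills.Theorems.CurvatureBoostCovariance.Negative.tie_beta_zero_factorises
    r sch hβ (S₁ := fun n => T.schwinger n (fun _ => r.curvature)) hconv (n := 1 + 1) (by norm_num)
    ![u, v] (tensor₂ u v) (isTensorOf_tensor₂ u v) hod ![tensor₁ u, tensor₁ v]
    (fun i => by
      have key : ∀ w : 𝓢((EuclideanSpace ℝ (Fin 4)), ℝ), IsTensorOf (tensor₁ w) (fun _ => ofRealTest w) :=
        fun w x => by rw [isTensorOf_tensor₁ w x]; simp
      fin_cases i <;> simpa using key _)
  rw [h, Fin.prod_univ_two]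
  rfl

omit [IsTopologicalGroup G] in
/-- **Every witness of `YangMills` leaves `β = 0`**: for every compact simple `G` the witnessing Wilson scheme
has `β_k ≠ 0` for all large `k`.  (The crux's hypothesis speaks of fixed `β ≥ β₀` only; the passage `β_k → ∞`
with `a_k m(β_k) → Δ` is entirely inside the item.) [folklore] -/
theorem yangMills_witness_beta_ne_zero [IsTopologicalGroup G] (h : YangMills) (hG : IsCompactSimpleLieGroup G) :
    letI : MeasurableSpace G := borel G
    haveI : BorelSpace G := ⟨rfl⟩
    ∃ (r : LatticeRep G) (sch : SpeciesScheme (YMSpecies G)) (T : OSData (YMSpecies G) 4),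
      IsYangMillsFor r sch T ∧ T.IsNontrivial r.curvature ∧ ∀ᶠ k in atTop, sch.β k ≠ 0 := by
  letI : MeasurableSpace G := borel G
  haveI : BorelSpace G := ⟨rfl⟩
  -- buildfix 2026-08-19: the YangMills statement re-type (p116790) put `sch.HasWeakCouplingLimit` first in the
  -- witness tuple; it is discarded here.
  obtain ⟨r, sch, T, -, hYM, hnt, -, -⟩ := h G hG
  refine ⟨r, sch, T, hYM, hnt, ?_⟩
  by_contra hne
  rw [Filter.not_eventually] at hne
  exact not_isNontrivial_of_frequently_beta_zero' r sch T (hne.mono fun k hk => not_not.1 hk) hYM hnt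

end Conclusion

end Summit.QuantumFields.YangMills.Theorems.ClusteringToYangMills.Negative

end
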